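import Literature.AlgebraicGeometry.AbelianSchemes.AbelianSchemeKOfLFibres
import Literature.AlgebraicGeometry.AbelianSchemes.AbelianSchemeDualTransport
import Literature.AlgebraicGeometry.AbelianSchemes.IsLambdaOfAtSqOfGraphPullback
import Literature.AlgebraicGeometry.Morphisms.GeometricPointsLiftSurjective
import HarnessLib

/-!
# Mumford's construction, node N2b: `b ↦ 𝒫′|_{A′ × {b}}` is injective on the geometric points of `A′⁄K(L′)`

Layer `Literature/AlgebraicGeometry/AbelianSchemes`, namespace `Literature.AlgebraicGeometry.AbelianSchemes.AbelianSchemeOver`.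
THEOREMS ONLY (no definition, no named fact, no instance, no notation, no `sorry`; net Literature debt 0).

[MumfordAV1970] §13, Theorem p. 125 and its proof (with §8 Thm. 1 p. 77 and §6 Cor. 4 p. 59, the theorem of the square): for
the quotient `π : X → X̂ = X⁄K(L)` and the descended Poincaré bundle `P` with `(1 × π)^*P ≅ Λ(L)`, the slices satisfy
`P|_{X × {π x}} ≅ Λ(L)|_{X × {x}} ≅ T_x^*L ⊗ L⁻¹`, and `x ↦ T_x^*L ⊗ L⁻¹` is a homomorphism with kernel `K(L)`; hence two points
of `X̂` with isomorphic slices are EQUAL — the injectivity that makes the seesaw graph a graph ([MumfordFogartyKirwan1994] Ch. 6 §2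
p. 121; [MilneAV2008] I §8 pp. 36–37, the «unique» of the universal property at field-valued points).

THIS FILE proves the statement RELATIVE to a base `S′`, at GEOMETRIC points, from exactly the clauses the F-3 (M) child line
(`Cruxes/HDel/Lines/F3DualAbelianSchemeM`, letter (Mb)) delivers: an `S′`-homomorphism `π : A′ → hat`, surjective and locally
of finite type on the underlying schemes, whose kernel CONTAINS `K(L′)` on `T`-valued points («`u ∈ K(L′)(T) ⇒ u ≫ π = 1`»), and
a module `𝒫′` on `A′ ×_{S′} hat` with the SOCKET `(1 × π)^*𝒫′ ≅ Λ(L′)`: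

* `nonempty_pullback_baseChangeToProd_iso_mumfordBundle_of_socket` — the SLICE FORMULA: for an `S′`-point `x : T → A′` over `f`,
  `(1 × (x ≫ π))^*𝒫′ ≅ (1 × x)^*Λ(L′)` (★ `baseChangeToProd_comp`, ★ `baseChangeToProd_eq_whiskerLeft_left`);
* **`eq_of_nonempty_pullback_baseChangeToProd_iso_of_socket`** — N2B: for geometric points `y, y′` of `hat` over the same
  geometric point `s̄` of `S′`, `(1 × y)^*𝒫′ ≅ (1 × y′)^*𝒫′` on `A′_{s̄}` implies `y = y′`.  Proof: lift `y, y′` along the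
  surjective `π` to `x, x′` (★ `Morphisms.exists_over_comp_eq_of_surjective`), read the slices as `Λ(L′)|_x ≅ Λ(L′)|_{x′}`
  (slice formula), pass to the partner points `Q, Q′ ∈ A′_{s̄}(Ω)` (★ `exists_points_fibrePointToLeft_eq`) where the class of
  `Λ(L′)|_x` is `φ_c(Q) = t_Q^*c · c⁻¹` (★ `pullback_whiskerLeft_mumfordClass_homMk`), use that `φ_c` is a HOMOMORPHISM (the
  theorem of the square on the abelian VARIETY `A′_{s̄}`, ★ `phiPic_mul'`/`phiPic_inv'`) to get `φ_c(Q′Q⁻¹) = 1`, i.e.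
  `u_{Q′Q⁻¹} ∈ K(L′)(Ω)` (★ `memKOfL_homMk_iff_phiPic_eq_one`), hence `u_{Q′Q⁻¹} ≫ π = 1` (kernel clause) and
  `x′ ≫ π = x ≫ π` (★ `fibrePointToLeft_mul`, `MonObj.mul_comp`).

This is node N2b of the ℂ-engine port (★ `Motives/PoincareUniversal/GraphCondInjectivePoints.graphCond_injective_points` is the
`Spec ℂ` case through `dualOf`); cell `hodgecm-mathlib` (D-0151), FLOOR 0 P1, (Mc) spine (B-plan1 (g19) 19:48:19Z: N2b = B-p16
(g18)).  Count-neutral; HC_CM is proved only modulo the 7 printed citations until rung 0 closes; nothing here is about HC.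

Mathlib searched (pin): `MonObj.mul_comp`, `Over.OverMorphism.ext`, `mul_inv_eq_one`, `div_eq_iff`; Mathlib has no abelian
schemes and no Poincaré bundle.

## References
* [MumfordAV1970] D. Mumford, *Abelian Varieties* (1970), §6 Cor. 4 (p. 59), §8 Thm. 1 (p. 77), §13 (Thm. p. 125 and its proof).
* [MumfordFogartyKirwan1994] D. Mumford, J. Fogarty, F. Kirwan, *GIT* 3rd ed. (1994), Ch. 6 §2 (pp. 120–121).
* [MilneAV2008] J. S. Milne, *Abelian Varieties* (v2.00, 2008), I §8 pp. 36–37.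
* [Lange2023AbelianVarietiesC] H. Lange, *Abelian Varieties over the Complex Numbers* (2023), §1.4.2, Thm. 1.3.5.
-/

set_option autoImplicit false

noncomputable section

-- `Scheme.Modules` / `SheafOfModules` are not reducible; `(A.X ⊗ B.X).left = A.prodLeft B` and
-- `(A.fibre s).toAbelianVariety.X.left = (A.X ⊗ Over.mk s).left` hold by `rfl` only.
set_option backward.isDefEq.respectTransparency false

universe u

open CategoryTheory CategoryTheory.Limits AlgebraicGeometry MonoidalCategory CartesianMonoidalCategory
open scoped MonObj

namespace Literature.AlgebraicGeometry.AbelianSchemes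

open Literature.AlgebraicGeometry.Modules Literature.AlgebraicGeometry.Motives Literature.AlgebraicGeometry.AbelianVarieties

namespace AbelianSchemeOver

variable {S' : Scheme.{u}} (A' hat : AbelianSchemeOver S') (π : A'.X ⟶ hat.X) {L' : A'.left.Modules}
  (P : (A'.prodLeft hat).Modules)
  (hsock : Nonempty ((Scheme.Modules.pullback (A'.X ◁ π).left).obj P ≅ A'.mumfordBundle L'))

/-! ## §1 The slice formula `(1 × (x ≫ π))^*𝒫′ ≅ (1 × x)^*Λ(L′)` -/

include hsock in
/-- **Slice formula**: for an `S′`-point `x : T → A′` (`T ∈ Over S′`), the slice of `𝒫′` at the point `x ≫ π` of `hat` is the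
slice of `Λ(L′)` at `x`: `(1 × (x ≫ π))^*𝒫′ ≅ (1 × x)^*(1 × π)^*𝒫′ ≅ (1 × x)^*Λ(L′)` (★ `baseChangeToProd_comp`, the socket, ★
`baseChangeToProd_eq_whiskerLeft_left`). [cite: MumfordAV1970, §13 (Thm. p. 125, proof: `P|_{X × {π x}} ≅ Λ(L)|_{X × {x}}`)]
[cite: MilneAV2008, I §8 pp. 36–37] -/
theorem nonempty_pullback_baseChangeToProd_iso_mumfordBundle_of_socket {T : Over S'} (x : T ⟶ A'.X)
    (y : T.left ⟶ hat.X.left) (hy : y ≫ hat.X.hom = T.hom) (hxy : x.left ≫ π.left = y) :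
    Nonempty ((Scheme.Modules.pullback (A'.baseChangeToProd hat T.hom y hy)).obj P ≅
      (Scheme.Modules.pullback (A'.X ◁ x).left).obj (A'.mumfordBundle L')) := by
  obtain ⟨e⟩ := hsock
  have hc : A'.baseChangeToProd hat T.hom y hy =
      A'.baseChangeToProd A' T.hom x.left (Over.w x) ≫ (A'.X ◁ π).left := by
    rw [A'.baseChangeToProd_congr hat T.hom hxy.symm hy (by rw [Category.assoc, Over.w π]; exact Over.w x),
      DualPair.baseChangeToProd_comp (A := A') (B := hat) (B' := A') T.hom x.left π.left (Over.w x) (Over.w π),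
      A'.baseChangeToProd_eq_whiskerLeft_left hat π]
  exact ⟨(Scheme.Modules.pullbackCongr hc).app P ≪≫ ((Scheme.Modules.pullbackComp _ _).app P).symm ≪≫
    (Scheme.Modules.pullback (A'.baseChangeToProd A' T.hom x.left (Over.w x))).mapIso e ≪≫
    (Scheme.Modules.pullbackCongr (A'.baseChangeToProd_eq_whiskerLeft_left A' x)).app (A'.mumfordBundle L')⟩

/-! ## §2 Injectivity on geometric points -/

/-- The class of the slice `Λ(L′)|_x` at a geometric point, read on the partner `Q ∈ A′_{s̄}(Ω)` of `x`: it is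
`φ_{c_s}(Q) · 1`-style, precisely `(1 × u_Q)^*[Λ]c = t_Q^*c_s · c_s⁻¹` (★ `pullback_whiskerLeft_mumfordClass_homMk`); two fibre
points with isomorphic `Λ`-slices have partners with the same `φ_{c_s}` (rank-one modules are classified by their class, ★
`nonempty_iso_iff_detClass_eq`). [cite: MumfordAV1970, §8 Thm. 1 (p. 77) and §13 (p. 123)] [cite: Lange2023AbelianVarietiesC, §1.4.2] -/
theorem phiPic_eq_of_nonempty_pullback_whiskerLeft_mumfordBundle_iso (hL' : HasRank L' 1) {Ω : Type u} [Field Ω]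
    (s : Spec (.of Ω) ⟶ S') (Q Q' : (A'.fibre s).toAbelianVariety.Points Ω)
    (h : Nonempty ((Scheme.Modules.pullback (A'.X ◁ (Over.homMk (A'.fibrePointToLeft s Q) (A'.fibrePointToLeft_comp_hom s Q) :
        Over.mk s ⟶ A'.X)).left).obj (A'.mumfordBundle L') ≅
      (Scheme.Modules.pullback (A'.X ◁ (Over.homMk (A'.fibrePointToLeft s Q') (A'.fibrePointToLeft_comp_hom s Q') :
        Over.mk s ⟶ A'.X)).left).obj (A'.mumfordBundle L'))) :
    phiPic (A'.fibre s).toAbelianVariety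
        (CechPic.pullback (X := (A'.fibre s).toAbelianVariety.X.left) (pullback.fst A'.X.hom s)
          (detClass (HasRank.isFiniteLocallyFree' hL'))) Q =
      phiPic (A'.fibre s).toAbelianVariety
        (CechPic.pullback (X := (A'.fibre s).toAbelianVariety.X.left) (pullback.fst A'.X.hom s)
          (detClass (HasRank.isFiniteLocallyFree' hL'))) Q' := by
  obtain ⟨e⟩ := h
  have hΛ := A'.hasRank_mumfordBundle hL'
  have hΛ₁ := HasRank.isFiniteLocallyFree' hΛ
  -- equality of the classes of the two slices
  have hcl := detClass_eq_of_iso e (hΛ₁.pullback _) (hΛ₁.pullback _)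
  rw [detClass_pullback _ hΛ₁, detClass_pullback _ hΛ₁, A'.detClass_mumfordBundle hL' hΛ₁,
    A'.pullback_whiskerLeft_mumfordClass_homMk, A'.pullback_whiskerLeft_mumfordClass_homMk] at hcl
  -- cancel the common factor `c_s⁻¹`
  have hcl' := mul_right_cancel hcl
  -- `φ_c(Q) = t_Q^*c / c`
  change _ / _ = _ / _
  exact congrArg (· / _) hcl'

variable [IsMonHom π] [Surjective π.left] [LocallyOfFiniteType π.left]

include hsock in
/-- **N2B — `b ↦ 𝒫′|_{A′ × {b}}` IS INJECTIVE ON GEOMETRIC POINTS OF `hat`** ([MumfordAV1970] §13 Theorem, proof; the field-valued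
«unique» of [MilneAV2008] I §8): let `π : A′ → hat` be an `S′`-homomorphism, surjective and locally of finite type, whose kernel
contains `K(L′)` on `T`-valued points, and `𝒫′` a module on `A′ ×_{S′} hat` with `(1 × π)^*𝒫′ ≅ Λ(L′)`, `L′` of rank one.  If
two geometric points `y, y′` of `hat` over the same `s̄ : Spec Ω → S′` have isomorphic slices `(1 × y)^*𝒫′ ≅ (1 × y′)^*𝒫′` on
`A′_{s̄}`, then `y = y′`: lifting along `π` (surjective on geometric points), the slices are `Λ(L′)|_x ≅ Λ(L′)|_{x′}`, so the
partner points `Q, Q′ ∈ A′_{s̄}(Ω)` satisfy `φ_c(Q) = φ_c(Q′)`; `φ_c` being a homomorphism (theorem of the square on the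
fibre, ★ `phiPic_mul'`), `φ_c(Q′Q⁻¹) = 1`, i.e. `u_{Q′Q⁻¹} ∈ K(L′)(Ω) ⊆ ker π`, whence `x′ ≫ π = x ≫ π`.
[cite: MumfordAV1970, §13 Theorem (p. 125) and its proof; §8 Thm. 1 (p. 77); §6 Cor. 4 (p. 59)]
[cite: MumfordFogartyKirwan1994, Ch. 6 §2 (p. 121)] [cite: MilneAV2008, I §8 pp. 36–37] -/
theorem eq_of_nonempty_pullback_baseChangeToProd_iso_of_socket (hL' : HasRank L' 1)
    (hker : ∀ (T : Over S') (u : T ⟶ A'.X), A'.MemKOfL L' u → u ≫ π = 1)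
    {Ω : Type u} [Field Ω] [IsAlgClosed Ω] (s : Spec (.of Ω) ⟶ S') (y y' : Spec (.of Ω) ⟶ hat.X.left)
    (hy : y ≫ hat.X.hom = s) (hy' : y' ≫ hat.X.hom = s)
    (h : Nonempty ((Scheme.Modules.pullback (A'.baseChangeToProd hat s y hy)).obj P ≅
      (Scheme.Modules.pullback (A'.baseChangeToProd hat s y' hy')).obj P)) :
    y = y' := by
  -- lifts of `y`, `y′` along `π` to `Ω`-points of `A′` over `s̄`
  obtain ⟨x, hx⟩ := Morphisms.exists_over_comp_eq_of_surjective π s (Over.homMk y hy : Over.mk s ⟶ hat.X)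
  obtain ⟨x', hx'⟩ := Morphisms.exists_over_comp_eq_of_surjective π s (Over.homMk y' hy' : Over.mk s ⟶ hat.X)
  have hxy : x.left ≫ π.left = y := by rw [← Over.comp_left, hx]; rfl
  have hxy' : x'.left ≫ π.left = y' := by rw [← Over.comp_left, hx']; rfl
  -- their partners `Q`, `Q′` in the fibre `A′_{s̄}`
  obtain ⟨Q, hQ⟩ := A'.exists_points_fibrePointToLeft_eq s x
  obtain ⟨Q', hQ'⟩ := A'.exists_points_fibrePointToLeft_eq s x'
  have hxQ : x = Over.homMk (A'.fibrePointToLeft s Q) (A'.fibrePointToLeft_comp_hom s Q) := Over.OverMorphism.ext hQ.symm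
  have hxQ' : x' = Over.homMk (A'.fibrePointToLeft s Q') (A'.fibrePointToLeft_comp_hom s Q') :=
    Over.OverMorphism.ext hQ'.symm
  -- slices of `𝒫′` at `y`, `y′` = slices of `Λ(L′)` at `x`, `x′`
  obtain ⟨ex⟩ := A'.nonempty_pullback_baseChangeToProd_iso_mumfordBundle_of_socket hat π P hsock x y
    (by rw [hy]; rfl) hxy
  obtain ⟨ex'⟩ := A'.nonempty_pullback_baseChangeToProd_iso_mumfordBundle_of_socket hat π P hsock x' y'
    (by rw [hy']; rfl) hxy'
  obtain ⟨i⟩ := h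
  have hΛ : Nonempty ((Scheme.Modules.pullback (A'.X ◁ x).left).obj (A'.mumfordBundle L') ≅
      (Scheme.Modules.pullback (A'.X ◁ x').left).obj (A'.mumfordBundle L')) := ⟨ex.symm ≪≫ i ≪≫ ex'⟩
  rw [hxQ, hxQ'] at hΛ
  -- `φ_c(Q) = φ_c(Q′)`, hence `φ_c(Q′ Q⁻¹) = 1`
  have hφ := A'.phiPic_eq_of_nonempty_pullback_whiskerLeft_mumfordBundle_iso hL' s Q Q' hΛ
  have hφ1 : phiPic (A'.fibre s).toAbelianVariety
      (CechPic.pullback (X := (A'.fibre s).toAbelianVariety.X.left) (pullback.fst A'.X.hom s)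
        (detClass (HasRank.isFiniteLocallyFree' hL'))) (Q' * Q⁻¹) = 1 := by
    rw [phiPic_mul', phiPic_inv', ← hφ, mul_inv_cancel]
  -- so `u_{Q′Q⁻¹} ∈ K(L′)(Ω)` and is killed by `π`
  have hmem := (A'.memKOfL_homMk_iff_phiPic_eq_one s hL' (Q' * Q⁻¹)).2 hφ1
  have hkill := hker _ _ hmem
  -- `u_{Q′Q⁻¹} = x′ · x⁻¹` in `A′(Spec Ω / s̄)`
  have hprod : (Over.homMk (A'.fibrePointToLeft s (Q' * Q⁻¹)) (A'.fibrePointToLeft_comp_hom s (Q' * Q⁻¹)) :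
      Over.mk s ⟶ A'.X) * x = x' := by
    apply Over.OverMorphism.ext
    have e1 := A'.fibrePointToLeft_mul s (Q' * Q⁻¹) Q
    rw [inv_mul_cancel_right] at e1
    rw [hxQ, hxQ']
    exact e1.symm
  -- conclude: `x′ ≫ π = (u ≫ π) · (x ≫ π) = x ≫ π`
  have hππ : x' ≫ π = x ≫ π := by
    rw [← hprod, MonObj.mul_comp, hkill, one_mul]
  have e : (Over.homMk y' hy' : Over.mk s ⟶ hat.X) = Over.homMk y hy := hx'.symm.trans (hππ.trans hx)
  exact (congrArg CommaMorphism.left e).symm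

end AbelianSchemeOver

end Literature.AlgebraicGeometry.AbelianSchemes

end
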